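import Summits.AtomisticToContinuum.HydrodynamicLimit.Theses.PesinPricing
import Summits.AtomisticToContinuum.HydrodynamicLimit.Theorems.TwoClocksEntropyToHydro

/-!
# Route PesinPricing — the `Assembly` frame (item stmt-AtomisticToContinuum-14653): reductions

`PesinPricing.Assembly` is the frame statement
`UpperVolumeLemma → KiferYoungUpperR → PesinSaturationRigidityR → EnergyCurrentTails →
HydrodynamicLimit` ("the line's primary cruxes imply the Statement").
It is NOT a hypothesis of the route's deciding theorem `PesinPricing.closes`
(`closes hV hKY hR hPG hT hG`), and it is not a composition of the route's items either: it is
`closes` with its two GLUE CRUXES folded in — `PricingGlue` (stmt-AtomisticToContinuum-14643,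
`UpperVolumeLemma → KiferYoungUpperR → PesinSaturationRigidityR → PricedBoltzmannProperty`) and
`GronwallU` (stmt-AtomisticToContinuum-14536, `PricedBoltzmannProperty → EnergyCurrentTails →
RelEntropyVanishing`) — "contentful by design" (route file, §Assembly). Relative to its four
antecedents its content is exactly the unprinted pricing chain (DefectRate, Palm piecing) and the
noiseless Olla–Varadhan–Yau relative-entropy Gronwall.

This file records, sorry-free and against the live route module, the pure-logic facts that pin the
item to the ledger's other statements (the twin of `TwoClocksAssembly.lean` /
`OneFlightGossipEngineAssembly.lean` for the sibling routes):

* `pesinPricing_assembly_of_pricingGlue_of_gronwallU` — `PricingGlue → GronwallU → Assembly`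
  (by `closes`): the item closes by a one-liner the moment stmt-14643 and stmt-14536 land;
* `pesinPricing_assembly_of_pricedBoltzmannProperty_of_gronwallU` — equally from the intermediate
  target `PricedBoltzmannProperty` (stmt-AtomisticToContinuum-14419) and `GronwallU`, the three
  mechanism cruxes then being idle;
* `pesinPricing_assembly_of_chain` — from ANY derivation of the typed target `RelEntropyVanishing`
  (stmt-AtomisticToContinuum-0766) out of the four antecedents, through the landed entropy-inequality
  theorem `hydrodynamicLimit_of_relEntropyVanishing` (file `TwoClocksEntropyToHydro.lean`);
* `pesinPricing_assembly_of_relEntropyVanishing`, `pesinPricing_assembly_of_hydrodynamicLimit` —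
  the target alone, resp. the sub-problem Statement itself, closes the frame with all antecedents
  idle; in particular a refutation `¬ Assembly` would refute the summit conjunct
  `HydrodynamicLimit` (there is no degenerate `¬`-settlement);
* `pesinPricing_assembly_iff` — the uncurried form: `Assembly` is the single implication
  "`V ∧ KY ∧ R ∧ T → HydrodynamicLimit`";
* `pesinPricing_hydrodynamicLimit_of_assembly` — conversely, given the four cruxes the frame IS the
  Statement (modus ponens), so the item has no content of its own besides the glue.

Nothing here claims mathematical content beyond bookkeeping.
-/

namespace Summit.AtomisticToContinuum.HydrodynamicLimit.Theorems

open Summit.AtomisticToContinuum.HydrodynamicLimit.Theses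

/-! ### The two glue cruxes close the frame -/

/-- **The glue closes the frame** (the closing recipe of stmt-AtomisticToContinuum-14653): from the
glue cruxes `PricingGlue` (stmt-AtomisticToContinuum-14643) and `GronwallU`
(stmt-AtomisticToContinuum-14536) the item follows by the route's deciding theorem
`PesinPricing.closes`, the four antecedents of `Assembly` supplying its remaining hypotheses.
[folklore] -/
theorem pesinPricing_assembly_of_pricingGlue_of_gronwallU (hPG : PesinPricing.PricingGlue)
    (hG : PesinPricing.GronwallU) : PesinPricing.Assembly :=
  fun hV hKY hR hT => PesinPricing.closes hV hKY hR hPG hT hG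

/-- **The pricing output and the Gronwall glue close the frame.** From the intermediate target
`PricedBoltzmannProperty` (stmt-AtomisticToContinuum-14419) and `GronwallU`
(stmt-AtomisticToContinuum-14536) the item follows through the landed entropy-inequality theorem
`hydrodynamicLimit_of_relEntropyVanishing` (which reaches the UNGUARDED Literature conjecture) and
the registry bridge `HydrodynamicLimit.of_unguarded` to the packing-guarded Statement (re-type p126922);
the three mechanism antecedents `UpperVolumeLemma`, `KiferYoungUpperR`, `PesinSaturationRigidityR`
are then idle. [folklore] -/
theorem pesinPricing_assembly_of_pricedBoltzmannProperty_of_gronwallU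
    (hPBP : PesinPricing.PricedBoltzmannProperty) (hG : PesinPricing.GronwallU) :
    PesinPricing.Assembly :=
  fun _ _ _ hT =>
    _root_.HydrodynamicLimit.of_unguarded (hydrodynamicLimit_of_relEntropyVanishing (hG hPBP hT))

/-! ### Any derivation of the entropy target from the four cruxes closes the frame -/

/-- **Reaching the target suffices.** If the four antecedents yield the typed target
`RelEntropyVanishing` (stmt-AtomisticToContinuum-0766: `o(N)` relative entropy at time `t` with
respect to a reference local Gibbs law whose fields concentrate exponentially around the Euler
fields), then `Assembly` holds: the last step `RelEntropyVanishing → HydrodynamicLimit` is the landed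
theorem `hydrodynamicLimit_of_relEntropyVanishing` (unguarded Literature conjecture) followed by the
registry bridge `HydrodynamicLimit.of_unguarded` (packing-guarded Statement, re-type p126922). This is
the exact residual obligation of the item. [cite: Yau1991, §2] [cite: KipnisLandim1999, Ch. 6 §1] -/
theorem pesinPricing_assembly_of_chain
    (h : PesinPricing.UpperVolumeLemma → PesinPricing.KiferYoungUpperR →
      PesinPricing.PesinSaturationRigidityR → PesinPricing.EnergyCurrentTails →
      PesinPricing.RelEntropyVanishing) :
    PesinPricing.Assembly :=
  fun hV hKY hR hT =>
    _root_.HydrodynamicLimit.of_unguarded (hydrodynamicLimit_of_relEntropyVanishing (h hV hKY hR hT))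

/-- **The entropy target closes the frame.** A direct proof of the shared typed target
`RelEntropyVanishing` (stmt-AtomisticToContinuum-0766) closes the item with its four antecedents
idle. [cite: Yau1991, §2] -/
theorem pesinPricing_assembly_of_relEntropyVanishing (hRE : PesinPricing.RelEntropyVanishing) :
    PesinPricing.Assembly :=
  pesinPricing_assembly_of_chain fun _ _ _ _ => hRE

/-! ### The Statement itself closes the frame (no `¬`-settlement short of `¬ HydrodynamicLimit`) -/

/-- **The Statement closes the frame.** `Assembly` concludes the sub-problem Statement
`_root_.HydrodynamicLimit`, so it follows from the Statement with all four antecedents idle; hence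
`¬ Assembly → ¬ HydrodynamicLimit`. [folklore] -/
theorem pesinPricing_assembly_of_hydrodynamicLimit (h : _root_.HydrodynamicLimit) :
    PesinPricing.Assembly :=
  fun _ _ _ _ => h

/-! ### The frame, uncurried; and the frame given its antecedents -/

/-- **`Assembly`, uncurried.** The item is the single implication from the conjunction of the four
cruxes `UpperVolumeLemma ∧ KiferYoungUpperR ∧ PesinSaturationRigidityR ∧ EnergyCurrentTails` to the
sub-problem Statement. [folklore] -/
theorem pesinPricing_assembly_iff :
    PesinPricing.Assembly ↔
      (PesinPricing.UpperVolumeLemma ∧ PesinPricing.KiferYoungUpperR ∧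
          PesinPricing.PesinSaturationRigidityR ∧ PesinPricing.EnergyCurrentTails →
        _root_.HydrodynamicLimit) :=
  ⟨fun hA h => hA h.1 h.2.1 h.2.2.1 h.2.2.2, fun h hV hKY hR hT => h ⟨hV, hKY, hR, hT⟩⟩

/-- **Given the four cruxes, the frame IS the Statement** (modus ponens): together with
`pesinPricing_assembly_of_hydrodynamicLimit` this says that, once `UpperVolumeLemma`,
`KiferYoungUpperR`, `PesinSaturationRigidityR` and `EnergyCurrentTails` hold, `Assembly` and
`HydrodynamicLimit` are equivalent — the item carries exactly the content of the two glue cruxes and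
nothing that could be settled independently of them. [folklore] -/
theorem pesinPricing_hydrodynamicLimit_of_assembly (hA : PesinPricing.Assembly)
    (hV : PesinPricing.UpperVolumeLemma) (hKY : PesinPricing.KiferYoungUpperR)
    (hR : PesinPricing.PesinSaturationRigidityR) (hT : PesinPricing.EnergyCurrentTails) :
    _root_.HydrodynamicLimit :=
  hA hV hKY hR hT

end Summit.AtomisticToContinuum.HydrodynamicLimit.Theorems
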